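import Literature.NumberTheory.LFunctions.Zhang2022.KnifeEdgeLenZDegreeKernels

/-!
# Zhang (2022), rung F-S3 (Landau–Siegel programme, §D edge len = E*-len⁺): route `ZDegreeToeplitzBand`, item α1 —
# SLOT SYMMETRY and SLOT HOMOGENEITY TYPES: the zero-cost identities the census formulas `X₁^ψ, Y₁^ψ, X₂^ψ` must satisfy
# on in-class arguments (else they «prove» `ForAllLarge ¬(A)` from their own table alone — a derivation alarm), PROVED

Y. Zhang, *Discrete mean estimates and the Landau–Siegel zero*, arXiv:2211.02515v1 [Zhang2022LandauSiegel] — an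
unrefereed manuscript under adjudication. **WHAT THIS IS NOT: not a claim about Theorems 1–2 of arXiv:2211.02515, about
Landau–Siegel zeros, or about Parity. The programme SEARCHES and TYPES; no claim about Landau–Siegel zeros, Theorems 1–2 of
arXiv:2211.02515 or a repaired Margin232 until a kernel theorem says so.** No table of the route is DEFINED here (item α1,
`defn-PsiGradedClosedForms`, pending the archimedean census); nothing about the route's slots (`CrossTablePsi`,
`DualCrossTablePsi`, `TauTwoTablePsi` of `KnifeEdgeLenZDegreePsi`) or its closing alternative (`GradedCloses`) changes.

WHAT IS PROVED (method: the slots pin their functional on in-class pairs unless (A) fails eventually —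
`KnifeEdgeLenZDegreeBarrier.crossTablePsi_unique` / `asympConst_unique` — and the graded mean `zDegMeanPsi` has exact termwise
symmetries). Part 1 (critic ls-knife-crit-1 g3, probe `SlotSymmetry-ZDegreeToeplitzBand.lean` sha16 368a7a379d46da1c, folded
verbatim): the CROSS slots (d = 1 for `X₁`, d = 2 for `X₂`) pair `conj Q_g` with `conj H_f`, symmetric termwise ⇒
`crossTablePsi_symm_of_notA_io : X f f' g g' = X g g' f f'` on in-class pairs on the (A)-recurrent horn; an asymmetric value gives
`ForAllLarge ¬(A)` (`eventually_notA_of_crossTablePsi_asymm`). NOT forced: `Y₁ = X₁` (different data types on the two slots).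
Part 2 (typer ls-knife-typer-1 g5): `profPoly` is linear in the profile (`profPoly_smul`) and in-class pieces are a complex cone
(`InClassPiece.smul`), so each slot pins the HOMOGENEITY TYPE of its functional: cross slots are CONJUGATE-homogeneous in BOTH
pieces (`crossTablePsi_conj_smul_left_of_notA_io`, `crossTablePsi_conj_smul_right_of_notA_io`), the dual slot is homogeneous in
its first piece and conjugate-homogeneous in its second (`dualCrossTablePsi_smul_left_of_notA_io`,
`dualCrossTablePsi_conj_smul_right_of_notA_io`) = `KnifeEdge.PairHomogeneous` type. CONSEQUENCE: a `PairHomogeneous` functional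
(LINEAR in the leg-0 pair — `kernelPair`, `pointPair`, … of `KnifeEdgeLenZDegreeKernels`) satisfies a cross slot on the
(A)-recurrent horn only by VANISHING on every in-class pair (`crossTablePsi_eq_zero_of_pairHomogeneous_of_notA_io`, `t = I`);
one live value rings the alarm (`eventually_notA_of_pairHomogeneous_crossTablePsi`, `eventually_notA_of_kernelPair_tauTwoTablePsi`).
So the α1 guard of record (critic pin (b) `PairHomogeneous`, 2026-08-27T03:53:53Z) is the right TYPE for `Y₁psi` and the wrong
type for `X₁psi`, `X₂psi`; for the cross forms the guard-implying shape is conjugate-homogeneity in BOTH pieces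
(`KnifeEdge.PairConjHomogeneous` of the companion leaf `KnifeEdgeLenZDegreeConjShapes`, which implies `VanishesOnZero` equally and
is realised by the kernel shapes precomposed with conjugation on the leg-0 pair, `conjLeft (kernelPair θ θ K₀₀ K₀₁ K₁₀ K₁₁ + …)` =
`∫∫ (K₀₀ conj f(x)·conj g(y) + …)`).

Typer: ls-knife-typer-1 (cell landau-siegel §D); Part 1 author: critic ls-knife-crit-1.

## References
* Y. Zhang, arXiv:2211.02515v1 (2022), §2 (2.16)–(2.17), (2.23)–(2.25); §7 Prop. 7.1 (7.2); §8 (8.5), Lemma 8.1.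
  [cite: Zhang2022LandauSiegel, §2 (2.16)–(2.17), §7 Prop 7.1 (7.2), §8 (8.5)]
-/

noncomputable section

open Complex Real ComplexConjugate

namespace Literature.NumberTheory.LFunctions.Zhang2022.KnifeEdge

open Repair Skeleton

/-! ### Part 1 — SLOT SYMMETRY (critic ls-knife-crit-1 g3, probe `SlotSymmetry-ZDegreeToeplitzBand.lean` 368a7a379d46da1c,
2026-08-27T04:36:49Z, folded verbatim): the CROSS-type slots (`CrossTablePsi c' d`, d = 1 for `X₁`, d = 2 for `X₂` since
`TauTwoTablePsi = CrossTablePsi c' 2`) are means `Σ Re𝔠*·Z^d·conj Q_g·conj H_f·Reω` — SYMMETRIC in the two pieces termwise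
(`basePiece`: leg 0 = `profPoly f` plain, legs 1, 2 = `conj ∘ profPoly g`) — so on the (A)-recurrent horn the pinned functional is
symmetric on in-class pairs, and the α1 closed forms must exhibit `X₁psi f f' g g' = X₁psi g g' f f'`, `X₂psi f f' g g' =
X₂psi g g' f f'` as FORMULA identities; an asymmetric value «proves» `ForAllLarge ¬(A)` from its own table alone (derivation alarm,
C1 first read). NOT forced: `Y₁psi = X₁psi` (the (2,1) and (1,0) slots pair different data TYPES — conj·plain vs conj·conj). -/

section SlotSymmetry

section Termwise

variable (c' : ℝ) {D : ℕ} (χ : DirichletCharacter ℂ D)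

/-- The cross-type graded mean `Σ Re𝔠*·Z^d·conj H·conj K·Re ω` is symmetric in its two pieces (termwise `mul_comm`).
[cite: Zhang2022LandauSiegel, §2 (2.16)–(2.17)] -/
theorem zDegMeanPsi_cross_swap (d : ℤ) (H K : Chr D → ℂ → ℂ) :
    zDegMeanPsi c' χ d (fun x t => conj (H x t)) K = zDegMeanPsi c' χ d (fun x t => conj (K x t)) H := by
  unfold zDegMeanPsi
  refine Finset.sum_congr rfl fun i _ => ?_
  ring

end Termwise

variable {c' : ℝ} {d : ℕ} {X : PairFunctional}

/-- A degree-`d` cross table for `X` is a degree-`d` cross table for the swapped functional. [cite: Zhang2022LandauSiegel, §8 (8.5)] -/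
theorem crossTablePsi_swap (h : CrossTablePsi c' d X) : CrossTablePsi c' d (fun f f' g g' => X g g' f f') := by
  intro f f' g g' hf hg ε hε
  refine (h g g' f f' hg hf ε hε).mono ?_
  intro D _ χ _ _ hT hA
  have := hT hA
  rwa [zDegMeanPsi_cross_swap] at this

/-- **On the (A)-recurrent horn the cross functional is symmetric on in-class pairs** (uniqueness of main terms,
`crossTablePsi_unique`): the α1 closed forms `X₁psi` (d = 1) and `X₂psi` (d = 2) must be symmetric as FORMULAS.
[cite: Zhang2022LandauSiegel, §2 (2.16)–(2.17), §8 (8.5)] -/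
theorem crossTablePsi_symm_of_notA_io (h : CrossTablePsi c' d X)
    (hA : ¬ ForAllLarge fun D _ χ => ¬ AssumptionA D χ) {f f' g g' : ℝ → ℂ} (hf : InClassPiece f f')
    (hg : InClassPiece g g') : X f f' g g' = X g g' f f' :=
  crossTablePsi_unique h (crossTablePsi_swap h) hA hf hg

/-- The same for the degree-2 slot (`TauTwoTablePsi = CrossTablePsi c' 2`). [cite: Zhang2022LandauSiegel, §8 (8.5)] -/
theorem tauTwoTablePsi_symm_of_notA_io {X₂ : PairFunctional} (h : TauTwoTablePsi c' X₂)
    (hA : ¬ ForAllLarge fun D _ χ => ¬ AssumptionA D χ) {f f' g g' : ℝ → ℂ} (hf : InClassPiece f f')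
    (hg : InClassPiece g g') : X₂ f f' g g' = X₂ g g' f f' :=
  crossTablePsi_symm_of_notA_io h hA hf hg

/-- Either (A) fails eventually, or an ASYMMETRIC value of a cross-slot functional on one in-class pair is impossible:
an α1 form with `X f f' g g' ≠ X g g' f f'` somewhere in class proves `ForAllLarge ¬(A)` from its own table ALONE — the
signature of a derivation error, not of a mechanism (critic pin «symmetry alarm»). [cite: Zhang2022LandauSiegel, §2 (2.16)] -/
theorem eventually_notA_of_crossTablePsi_asymm (h : CrossTablePsi c' d X) {f f' g g' : ℝ → ℂ}
    (hf : InClassPiece f f') (hg : InClassPiece g g') (hne : X f f' g g' ≠ X g g' f f') :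
    ForAllLarge fun D _ χ => ¬ AssumptionA D χ := by
  by_contra hA
  exact hne (crossTablePsi_symm_of_notA_io h hA hf hg)

end SlotSymmetry

/-! ### Part 2 — SLOT HOMOGENEITY TYPES (typer ls-knife-typer-1 g5, zero-cost, same method): the profile polynomial is LINEAR in
the profile (`profPoly_smul`) and in-class pieces are a cone under complex scalars (`InClassPiece.smul`), so on the (A)-recurrent
horn each slot pins the HOMOGENEITY TYPE of its functional on in-class arguments:
* CROSS slots (`CrossTablePsi c' d X`, both `X₁` and `X₂`): the mean pairs `conj Q_g` with `conj H_f` ⇒ `X` is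
  CONJUGATE-homogeneous in BOTH pieces — `X (t•f) (t•f') g g' = conj t·X f f' g g'` AND `X f f' (t•g) (t•g') = conj t·X f f' g g'`;
* DUAL slot (`DualCrossTablePsi c' d Y`, `Y₁`): the mean pairs `conj Q_{g₂}` with `Q_{g₁}` ⇒ `Y` is homogeneous in the first
  piece and conjugate-homogeneous in the second — exactly `PairHomogeneous` (Minors Part 3).
CONSEQUENCE (proved, `crossTablePsi_eq_zero_of_pairHomogeneous_of_notA_io`): a `PairHomogeneous` functional (LINEAR in the
leg-0 pair — the shape of `kernelPair`, `pointPair`, … of `KnifeEdgeLenZDegreeKernels`) can satisfy a CROSS slot on the (A)-recurrent horn only by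
VANISHING on every in-class pair (`t = I`: `I·X = −I·X`); one live in-class value of such a form proves `ForAllLarge ¬(A)` from its
table alone (`eventually_notA_of_pairHomogeneous_crossTablePsi`) — the same derivation alarm as Part 1. So the α1 guard of record
(critic pin (b), `PairHomogeneous`) is the right TYPE for `Y₁psi` and the WRONG type for `X₁psi`, `X₂psi`: for the cross forms the
guard-implying shape is conjugate-homogeneity in both pieces (`PairConjHomogeneous`, companion leaf `KnifeEdgeLenZDegreeConjShapes`,
implying `VanishesOnZero` equally), realised by the `KnifeEdgeLenZDegreeKernels` shapes precomposed with conjugation on leg 0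
(`conjLeft` there: `X₂psi := conjLeft (kernelPair θ θ K₀₀ K₀₁ K₁₀ K₁₁ + …)` = `∫∫ K conj f(x)·conj g(y) + …`). Nothing about the route's slots or
closing alternative changes; only which homogeneity predicate the census formulas of each slot must carry. -/

section SlotHomogeneity

section Termwise

variable (c' : ℝ) {D : ℕ} (χ : DirichletCharacter ℂ D)

/-- `profPoly` is homogeneous in the profile: `H_{t·g} = t·H_g`. [cite: Zhang2022LandauSiegel, §2 (2.23)–(2.25)] -/
theorem profPoly_smul (x : Chr D) (t : ℂ) (g : ℝ → ℂ) (N : ℕ) (s : ℂ) :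
    profPoly χ x (t • g) N s = t * profPoly χ x g N s := by
  unfold profPoly
  rw [Finset.mul_sum]
  refine Finset.sum_congr rfl fun n _ => ?_
  simp only [Pi.smul_apply, smul_eq_mul]
  ring

/-- A scalar pulls out of the FIRST table of the graded mean linearly. [cite: Zhang2022LandauSiegel, §2 (2.16)–(2.17)] -/
theorem zDegMeanPsi_smul_left (d : ℤ) (u : ℂ) (F G : Chr D → ℂ → ℂ) :
    zDegMeanPsi c' χ d (fun x t => u * F x t) G = u * zDegMeanPsi c' χ d F G := by
  unfold zDegMeanPsi
  rw [Finset.mul_sum]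
  refine Finset.sum_congr rfl fun i _ => ?_
  ring

/-- A scalar pulls out of the SECOND table of the graded mean conjugate-linearly. [cite: Zhang2022LandauSiegel, §2 (2.16)–(2.17)] -/
theorem zDegMeanPsi_smul_right (d : ℤ) (u : ℂ) (F G : Chr D → ℂ → ℂ) :
    zDegMeanPsi c' χ d F (fun x t => u * G x t) = conj u * zDegMeanPsi c' χ d F G := by
  unfold zDegMeanPsi
  rw [Finset.mul_sum]
  refine Finset.sum_congr rfl fun i _ => ?_
  simp only [map_mul]
  ring

end Termwise

/-- In-class pieces are closed under complex scalars (`Repair.KinkedProfile.smul`; the vanishing clauses scale).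
[cite: Zhang2022LandauSiegel, §7 Prop 7.1 p.44 (7.2)] -/
theorem InClassPiece.smul {u u' : ℝ → ℂ} (h : InClassPiece u u') (t : ℂ) : InClassPiece (t • u) (t • u') where
  kinked := by
    have hk := h.kinked.smul t
    exact hk
  vanish := fun y hy => by simp [h.vanish y hy]
  vanish' := fun y hy => by simp [h.vanish' y hy]

/-- scaling an asymptotic-constant bound by a fixed complex factor `u` (pure algebra: `ε/(‖u‖+1)·‖u‖ ≤ ε`).
[cite: Zhang2022LandauSiegel, §2 (2.16)] -/
private theorem scaled_asymp_bound {T X : ℂ} {A P ε : ℝ} (u : ℂ)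
    (hb : ‖T - X * A * P‖ ≤ ε / (‖u‖ + 1) * A * P) :
    ‖u * T - u * X * A * P‖ ≤ ε * A * P := by
  have h0 : 0 ≤ ε / (‖u‖ + 1) * A * P := (norm_nonneg _).trans hb
  have hne : (‖u‖ + 1) ≠ 0 := by positivity
  rw [show u * T - u * X * A * P = u * (T - X * A * P) by ring, norm_mul]
  calc ‖u‖ * ‖T - X * A * P‖ ≤ ‖u‖ * (ε / (‖u‖ + 1) * A * P) := mul_le_mul_of_nonneg_left hb (norm_nonneg u)
    _ ≤ (‖u‖ + 1) * (ε / (‖u‖ + 1) * A * P) := mul_le_mul_of_nonneg_right (by linarith) h0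
    _ = ε * A * P := by field_simp

variable {c' : ℝ} {d : ℕ} {X Y : PairFunctional}

/-- **A cross slot is conjugate-homogeneous in the leg-0 piece on the (A)-recurrent horn:** `X (t•f) (t•f') g g' =
conj t · X f f' g g'` on in-class pairs (the mean pairs `conj H_{t f} = conj t·conj H_f`; uniqueness `asympConst_unique`).
[cite: Zhang2022LandauSiegel, §2 (2.16)–(2.17), §8 (8.5)] -/
theorem crossTablePsi_conj_smul_left_of_notA_io (h : CrossTablePsi c' d X)
    (hA : ¬ ForAllLarge fun D _ χ => ¬ AssumptionA D χ) {f f' g g' : ℝ → ℂ} (hf : InClassPiece f f')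
    (hg : InClassPiece g g') (t : ℂ) : X (t • f) (t • f') g g' = conj t * X f f' g g' := by
  refine asympConst_unique (T := fun D _ χ => zDegMeanPsi c' χ d
      (fun x s => conj (profPoly χ x g (⌊bigP D⌋₊ + 1) s)) (fun x s => profPoly χ x (t • f) (⌊bigP D⌋₊ + 1) s))
    (fun ε hε => h _ _ g g' (hf.smul t) hg ε hε) (fun ε hε => ?_) hA
  have hε' : 0 < ε / (‖conj t‖ + 1) := by positivity
  refine (h f f' g g' hf hg _ hε').mono ?_
  intro D _ χ _ _ hT hAss
  have hb := hT hAss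
  have hprof : (fun (x : Chr D) (s : ℂ) => profPoly χ x (t • f) (⌊bigP D⌋₊ + 1) s) =
      fun x s => t * profPoly χ x f (⌊bigP D⌋₊ + 1) s := by
    funext x s
    exact profPoly_smul χ x t f _ s
  show ‖zDegMeanPsi c' χ d _ (fun x s => profPoly χ x (t • f) (⌊bigP D⌋₊ + 1) s) - _‖ ≤ _
  rw [hprof, zDegMeanPsi_smul_right]
  exact scaled_asymp_bound (conj t) hb

/-- **… and conjugate-homogeneous in the OTHER piece too:** `X f f' (t•g) (t•g') = conj t · X f f' g g'` on in-class pairs (the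
mean pairs `conj Q_{t g} = conj t·conj Q_g`). So a cross functional is conjugate-homogeneous in BOTH pieces — not `PairHomogeneous`.
[cite: Zhang2022LandauSiegel, §2 (2.16)–(2.17), §8 (8.5)] -/
theorem crossTablePsi_conj_smul_right_of_notA_io (h : CrossTablePsi c' d X)
    (hA : ¬ ForAllLarge fun D _ χ => ¬ AssumptionA D χ) {f f' g g' : ℝ → ℂ} (hf : InClassPiece f f')
    (hg : InClassPiece g g') (t : ℂ) : X f f' (t • g) (t • g') = conj t * X f f' g g' := by
  refine asympConst_unique (T := fun D _ χ => zDegMeanPsi c' χ d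
      (fun x s => conj (profPoly χ x (t • g) (⌊bigP D⌋₊ + 1) s)) (fun x s => profPoly χ x f (⌊bigP D⌋₊ + 1) s))
    (fun ε hε => h f f' _ _ hf (hg.smul t) ε hε) (fun ε hε => ?_) hA
  have hε' : 0 < ε / (‖conj t‖ + 1) := by positivity
  refine (h f f' g g' hf hg _ hε').mono ?_
  intro D _ χ _ _ hT hAss
  have hb := hT hAss
  have hprof : (fun (x : Chr D) (s : ℂ) => conj (profPoly χ x (t • g) (⌊bigP D⌋₊ + 1) s)) =
      fun x s => conj t * conj (profPoly χ x g (⌊bigP D⌋₊ + 1) s) := by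
    funext x s
    rw [profPoly_smul, map_mul]
  show ‖zDegMeanPsi c' χ d (fun x s => conj (profPoly χ x (t • g) (⌊bigP D⌋₊ + 1) s)) _ - _‖ ≤ _
  rw [hprof, zDegMeanPsi_smul_left]
  exact scaled_asymp_bound (conj t) hb

/-- The degree-2 instances (`TauTwoTablePsi = CrossTablePsi c' 2`): K1″'s functional `X₂` is conjugate-homogeneous in both pieces
on the (A)-recurrent horn. [cite: Zhang2022LandauSiegel, §8 (8.5), Lemma 8.1] -/
theorem tauTwoTablePsi_conj_smul_of_notA_io {X₂ : PairFunctional} (h : TauTwoTablePsi c' X₂)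
    (hA : ¬ ForAllLarge fun D _ χ => ¬ AssumptionA D χ) {f f' g g' : ℝ → ℂ} (hf : InClassPiece f f')
    (hg : InClassPiece g g') (t : ℂ) :
    X₂ (t • f) (t • f') g g' = conj t * X₂ f f' g g' ∧ X₂ f f' (t • g) (t • g') = conj t * X₂ f f' g g' :=
  ⟨crossTablePsi_conj_smul_left_of_notA_io h hA hf hg t, crossTablePsi_conj_smul_right_of_notA_io h hA hf hg t⟩

/-- **The dual slot is homogeneous in its FIRST piece on the (A)-recurrent horn:** `Y (t•g₁) (t•g₁') g₂ g₂' = t · Y g₁ g₁' g₂ g₂'`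
(the mean pairs `conj Q_{g₂}` with PLAIN `Q_{g₁}`). [cite: Zhang2022LandauSiegel, §2 (2.17), §8 (8.5)] -/
theorem dualCrossTablePsi_smul_left_of_notA_io (h : DualCrossTablePsi c' d Y)
    (hA : ¬ ForAllLarge fun D _ χ => ¬ AssumptionA D χ) {g₁ g₁' g₂ g₂' : ℝ → ℂ} (hg₁ : InClassPiece g₁ g₁')
    (hg₂ : InClassPiece g₂ g₂') (t : ℂ) : Y (t • g₁) (t • g₁') g₂ g₂' = t * Y g₁ g₁' g₂ g₂' := by
  refine asympConst_unique (T := fun D _ χ => zDegMeanPsi c' χ d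
      (fun x s => conj (profPoly χ x g₂ (⌊bigP D⌋₊ + 1) s)) (fun x s => conj (profPoly χ x (t • g₁) (⌊bigP D⌋₊ + 1) s)))
    (fun ε hε => h _ _ g₂ g₂' (hg₁.smul t) hg₂ ε hε) (fun ε hε => ?_) hA
  have hε' : 0 < ε / (‖t‖ + 1) := by positivity
  refine (h g₁ g₁' g₂ g₂' hg₁ hg₂ _ hε').mono ?_
  intro D _ χ _ _ hT hAss
  have hb := hT hAss
  have hprof : (fun (x : Chr D) (s : ℂ) => conj (profPoly χ x (t • g₁) (⌊bigP D⌋₊ + 1) s)) =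
      fun x s => conj t * conj (profPoly χ x g₁ (⌊bigP D⌋₊ + 1) s) := by
    funext x s
    rw [profPoly_smul, map_mul]
  show ‖zDegMeanPsi c' χ d _ (fun x s => conj (profPoly χ x (t • g₁) (⌊bigP D⌋₊ + 1) s)) - _‖ ≤ _
  rw [hprof, zDegMeanPsi_smul_right, Complex.conj_conj]
  exact scaled_asymp_bound t hb

/-- **… and conjugate-homogeneous in its SECOND piece:** `Y g₁ g₁' (t•g₂) (t•g₂') = conj t · Y g₁ g₁' g₂ g₂'` — so the dual
functional `Y₁` IS of `PairHomogeneous` type on in-class arguments. [cite: Zhang2022LandauSiegel, §2 (2.17), §8 (8.5)] -/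
theorem dualCrossTablePsi_conj_smul_right_of_notA_io (h : DualCrossTablePsi c' d Y)
    (hA : ¬ ForAllLarge fun D _ χ => ¬ AssumptionA D χ) {g₁ g₁' g₂ g₂' : ℝ → ℂ} (hg₁ : InClassPiece g₁ g₁')
    (hg₂ : InClassPiece g₂ g₂') (t : ℂ) : Y g₁ g₁' (t • g₂) (t • g₂') = conj t * Y g₁ g₁' g₂ g₂' := by
  refine asympConst_unique (T := fun D _ χ => zDegMeanPsi c' χ d
      (fun x s => conj (profPoly χ x (t • g₂) (⌊bigP D⌋₊ + 1) s)) (fun x s => conj (profPoly χ x g₁ (⌊bigP D⌋₊ + 1) s)))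
    (fun ε hε => h g₁ g₁' _ _ hg₁ (hg₂.smul t) ε hε) (fun ε hε => ?_) hA
  have hε' : 0 < ε / (‖conj t‖ + 1) := by positivity
  refine (h g₁ g₁' g₂ g₂' hg₁ hg₂ _ hε').mono ?_
  intro D _ χ _ _ hT hAss
  have hb := hT hAss
  have hprof : (fun (x : Chr D) (s : ℂ) => conj (profPoly χ x (t • g₂) (⌊bigP D⌋₊ + 1) s)) =
      fun x s => conj t * conj (profPoly χ x g₂ (⌊bigP D⌋₊ + 1) s) := by
    funext x s
    rw [profPoly_smul, map_mul]
  show ‖zDegMeanPsi c' χ d (fun x s => conj (profPoly χ x (t • g₂) (⌊bigP D⌋₊ + 1) s)) _ - _‖ ≤ _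
  rw [hprof, zDegMeanPsi_smul_left]
  exact scaled_asymp_bound (conj t) hb

/-- **A `PairHomogeneous` (linear-in-leg-0) functional satisfies a CROSS slot on the (A)-recurrent horn only by VANISHING on every
in-class pair** (`t = I`: `I·X = conj I·X = −I·X`). [cite: Zhang2022LandauSiegel, §2 (2.16)–(2.17), §8 (8.5)] -/
theorem crossTablePsi_eq_zero_of_pairHomogeneous_of_notA_io (hX : PairHomogeneous X) (h : CrossTablePsi c' d X)
    (hA : ¬ ForAllLarge fun D _ χ => ¬ AssumptionA D χ) {f f' g g' : ℝ → ℂ} (hf : InClassPiece f f')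
    (hg : InClassPiece g g') : X f f' g g' = 0 := by
  have h1 := hX.1 I f f' g g'
  have h2 := crossTablePsi_conj_smul_left_of_notA_io h hA hf hg I
  rw [h1, Complex.conj_I] at h2
  have h3 : (2 * I) * X f f' g g' = 0 := by linear_combination h2
  exact (mul_eq_zero.mp h3).resolve_left (mul_ne_zero two_ne_zero Complex.I_ne_zero)

/-- **HOMOGENEITY ALARM:** a `PairHomogeneous` functional that satisfies a cross slot and is LIVE on one in-class pair proves
`ForAllLarge ¬(A)` from its own table alone — a derivation (typing) error, not a mechanism. In particular NO non-trivial census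
formula for `X₁psi` / `X₂psi` can be built from the `KnifeEdgeLenZDegreeKernels` shapes as they stand (conjugate their leg-0 pair).
[cite: Zhang2022LandauSiegel, §2 (2.16), §8 (8.5)] -/
theorem eventually_notA_of_pairHomogeneous_crossTablePsi (hX : PairHomogeneous X) (h : CrossTablePsi c' d X)
    {f f' g g' : ℝ → ℂ} (hf : InClassPiece f f') (hg : InClassPiece g g') (hne : X f f' g g' ≠ 0) :
    ForAllLarge fun D _ χ => ¬ AssumptionA D χ := by
  by_contra hA
  exact hne (crossTablePsi_eq_zero_of_pairHomogeneous_of_notA_io hX h hA hf hg)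

/-- The instance that matters for K1″: a `kernelPair`-shaped `X₂` (`KnifeEdgeLenZDegreeKernels`) satisfying `TauTwoTablePsi` and live on one in-class
pair gives `ForAllLarge ¬(A)` by itself. [cite: Zhang2022LandauSiegel, §8 (8.5), Lemma 8.1] -/
theorem eventually_notA_of_kernelPair_tauTwoTablePsi {θ₁ θ₂ : ℝ} {K₀₀ K₀₁ K₁₀ K₁₁ : ℝ → ℝ → ℂ}
    (h : TauTwoTablePsi c' (kernelPair θ₁ θ₂ K₀₀ K₀₁ K₁₀ K₁₁)) {f f' g g' : ℝ → ℂ} (hf : InClassPiece f f')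
    (hg : InClassPiece g g') (hne : kernelPair θ₁ θ₂ K₀₀ K₀₁ K₁₀ K₁₁ f f' g g' ≠ 0) :
    ForAllLarge fun D _ χ => ¬ AssumptionA D χ :=
  eventually_notA_of_pairHomogeneous_crossTablePsi (pairHomogeneous_kernelPair θ₁ θ₂ K₀₀ K₀₁ K₁₀ K₁₁) h hf hg hne

end SlotHomogeneity

/-! ### Part 3 — the COSTUME-LEAK reading (critic ls-knife-crit-1 g3, probe `GuardVariance-ZDegreeToeplitzBand.lean` a71804af8ebf73cb,
2026-08-27T04:55:27Z, found independently of Part 2): each alarm of Parts 1–2 is BY ITSELF Zhang's Theorem 1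
(`Skeleton.theorem1_of_eventually_not_assumptionA`) — so an α1 file whose cross form is asymmetric, or `PairHomogeneous` and live, would
make K1″'s table alone «prove» Theorem 1: the signature of a mis-typed guard, not of a mechanism. C1 FAILS such a file. -/

section CostumeLeak

variable {c' : ℝ} {d : ℕ} {X : PairFunctional} {f f' g g' : ℝ → ℂ}

/-- **Costume leak, symmetry form:** a cross table with ONE asymmetric in-class value is by itself Theorem 1.
[cite: Zhang2022LandauSiegel, Theorem 1, §2 (2.16)] -/
theorem theorem1_of_crossTablePsi_asymm (h : CrossTablePsi c' d X) (hf : InClassPiece f f') (hg : InClassPiece g g')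
    (hne : X f f' g g' ≠ X g g' f f') : Theorem1 :=
  theorem1_of_eventually_not_assumptionA (eventually_notA_of_crossTablePsi_asymm h hf hg hne)

/-- **Costume leak, variance form (critic's `theorem1_of_pairHomogeneous_crossTable_ne_zero`):** K1″'s table for a `PairHomogeneous`,
somewhere-non-zero cross form is by itself Theorem 1. [cite: Zhang2022LandauSiegel, Theorem 1, §2 (2.16), §8 (8.5)] -/
theorem theorem1_of_pairHomogeneous_crossTablePsi_ne_zero (hX : PairHomogeneous X) (h : CrossTablePsi c' d X)
    (hf : InClassPiece f f') (hg : InClassPiece g g') (hne : X f f' g g' ≠ 0) : Theorem1 :=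
  theorem1_of_eventually_not_assumptionA (eventually_notA_of_pairHomogeneous_crossTablePsi hX h hf hg hne)

/-- … the `kernelPair` instance on the degree-2 slot. [cite: Zhang2022LandauSiegel, Theorem 1, §8 (8.5), Lemma 8.1] -/
theorem theorem1_of_kernelPair_tauTwoTablePsi_ne_zero {θ₁ θ₂ : ℝ} {K₀₀ K₀₁ K₁₀ K₁₁ : ℝ → ℝ → ℂ}
    (h : TauTwoTablePsi c' (kernelPair θ₁ θ₂ K₀₀ K₀₁ K₁₀ K₁₁)) (hf : InClassPiece f f') (hg : InClassPiece g g')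
    (hne : kernelPair θ₁ θ₂ K₀₀ K₀₁ K₁₀ K₁₁ f f' g g' ≠ 0) : Theorem1 :=
  theorem1_of_eventually_not_assumptionA (eventually_notA_of_kernelPair_tauTwoTablePsi h hf hg hne)

end CostumeLeak

end Literature.NumberTheory.LFunctions.Zhang2022.KnifeEdge

end
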